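import Mathlib
import Summits.MatrixMultiplication.MatrixMultiplication.Theses.LevelGradedCohnUmans
import Literature.RepresentationTheory.FiniteGroups.WedderburnBlocks
import Literature.RepresentationTheory.FiniteGroups.FourierInversionIdentity
import Literature.Computability.AlgebraicComplexity.BCGPUInfiniteGroupsProofs

/-!
# Line `fourier-support-repfun` — checked skeleton for the crux `GradedPricing`
(stmt-MatrixMultiplication-7611, route `LevelGradedCohnUmans`, rank 2; crux-plan round 1)

Crux (verbatim the route decl `…Theses.LevelGradedCohnUmans.GradedPricing`): for a finite group `G`,
a BI-INVARIANT test space `J ≤ ℂ^G` and a `J`-separated triple `X, Y, Z ⊆ G` (words `x⁻¹ y y'⁻¹ z`,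
Kronecker pattern), `(|X||Y||Z|)^(ω/3) ≤ Σᶠ_{χ ∈ Irr(G) ∩ J} χ(1)^ω` (`ω = omega ℂ`).

LINE (card `Cruxes/GradedPricing/Ideas/fourier-support-repfun.md`; triage r1: pass ×3, merge ≈
`matrix-unit-sandwich`).  Lever: the inversion-twisted lift `f ↦ f̌ := Σ_g f(g⁻¹)·g ∈ ℂ[G]`
(spelled out as `∑ g, MonoidAlgebra.single g (f g⁻¹)` in every statement, so that the stubs are
stated over existing declarations only) turns the read-out into the coefficient-of-`1` / trace form
(`coeff_one_invLift_mul_single`, `card_mul_apply_eq_sum_trace` — PROVED below) and bi-translation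
into two-sided multiplication (`single_mul_invLift_mul_single` — PROVED below).  For any Wedderburn
isomorphism `φ : ℂ[G] ≃ₐ ∏ᵢ ℂ^{dᵢ×dᵢ}` (`exists_algEquiv_pi_matrix`):

REGISTERED STUBS (the two halves of the Peter–Weyl containment; `sorry` only here):
* `stub_support` (M, HARDEST; the ONLY place bi-invariance is used, and it is used two-sidedly):
  `f ∈ J`, `φ(f̌)ᵢ ≠ 0` ⟹ `χᵢ ∈ J`.
* `stub_expansion` (S/M; `J`-free Fourier expansion at `1`): if `φ(f̌)` is supported on the blocks
  `{i : p i}` then `f ∈ repFun` of those blocks (as `GL`-valued homs `g ↦ (φ g)ᵢ`).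
PROVED HERE (real proofs, no `sorry`):
* the TRANSFER `C⁺ = le_repFun_charSupport`: `J ≤ repFun {i : χᵢ ∈ J}` from the two stubs;
* `sep_inv_dictionary` (consumes BOTH halves of the separation pattern): for `Y ≠ ∅` the inverted
  triple `(X⁻¹, Y⁻¹, Z⁻¹)` has the embedding TPP and a BCGPU separating family drawn from `J`;
* `sum_charSupport_rpow_le`: `Σ_{χᵢ ∈ J} dᵢ^s ≤ Σᶠ_{χ ∈ Irr(G) ∩ J} χ(1)^s`;
* `GradedPricing_of`: zero volume is `0 ≤ Σᶠ`; otherwise `Y ≠ ∅`, obtain `φ`, apply the tree's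
  PROVED `BCGPU2024_thm_2_2_corrected_holds` (BCGPU 2024 Thm 2.2, embedding TPP) to
  `(X⁻¹, Y⁻¹, Z⁻¹)` with `R_sep := {i // χᵢ ∈ J}`, rewrite `Finset.card_inv`, chain the budget
  comparison at `s = ω`.  Concludes `…LevelGradedCohnUmans.GradedPricing` BY NAME.

BOTH STUBS ARE ALREADY KERNEL-PROVED by this planner in the closed scratch
`line-fourier-support-repfun-closed.lean` (evidence on stmt-MatrixMultiplication-7611; rc 0, 0 sorries,
`GradedPricing_of` axioms `[propext, Classical.choice, Quot.sound]`); the proof scripts (helpers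
`lift_add/_smul/_zero/_sum`, `exists_mul_lift_mul_eq`, `sum_single_diag` + the two stub bodies) are
reproduced in the line card `Lines/fourier-support-repfun.md`, Appendix — paste, do not re-derive.

Disproof.lean (cdisprove cycle 1) obligations, honoured at named steps: `gradedPricing_false_without_biInv`
and `gradedPricing_false_with_leftInv_only` (landed as
`Theorems/GradedPricing/Negative/LoadBearing.lean`, `…/LeftInvariance.lean`) — bi-invariance enters
ONLY `stub_support`, TWO-sidedly (`single_mul_invLift_mul_single` multiplies on both sides; with
left-invariance alone `J̌` is merely a right ideal and a block is not swallowed — the `S₃` column-space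
witness); `gradedPricing_false_without_ones` / `_without_zeros` — both pattern halves are hypotheses
of `sep_inv_dictionary` (ones ⟹ clause 1 of `IsSeparatingFamily`, forcing the `Y = ∅` split; zeros ⟹
clause 2 AND the embedding TPP); `gradedPricing_attained` / `not_gradedPricing_strict` — the line
proves `≤` with constant `1`; the exponent is the tree's `omega ℂ` throughout (never `3`:
`GradedCubePacking` is never instantiated).  No stub is an instance of a landed Negative lemma
(scratch `scratch-negcheck.lean`: the skeleton co-elaborates with both Negative modules, rc 0).

PROVED twins in `Cruxes/GradedPricing/SketchIdeator1.lean` (line `matrix-unit-sandwich`, sorry-free):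
`stub_support` ↔ `character_mem_of_fourierCoeff_ne_zero` (detector `f̃(φ⁻¹E_ab) ≠ 0` in place of
`φ(f̌)ᵢ ≠ 0`), `stub_expansion` ↔ `eq_sum_fourierCoeff_mul` + `mem_repFun_visibleBlocks`,
`sep_inv_dictionary` = `bcgpu_hypotheses_of_separated`, `sum_charSupport_rpow_le` =
`sum_visibleBlocks_rpow_le`.
-/

set_option linter.dupNamespace false

noncomputable section

namespace Summit.MatrixMultiplication.MatrixMultiplication.Cruxes.GradedPricing.FourierSupportRepfun

open scoped BigOperators Classical Pointwise
open Literature.RepresentationTheory.FiniteGroups Literature.Computability.AlgebraicComplexity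

variable {G : Type} [Group G]
variable {r : ℕ} {d : Fin r → ℕ}

/-! ## Convention identities of the lever (PROVED; `f̌ = ∑ g, single g (f g⁻¹)`) -/

/-- The read-out functional is a coefficient of a product: `(f̌ · g).coeff 1 = f(g)`. -/
theorem coeff_one_invLift_mul_single [Fintype G] (f : G → ℂ) (g : G) :
    ((∑ h : G, MonoidAlgebra.single h (f h⁻¹)) * MonoidAlgebra.single g 1).coeff 1 = f g := by
  simp only [Finset.sum_mul, MonoidAlgebra.single_mul_single, mul_one,
    MonoidAlgebra.coeff_sum, MonoidAlgebra.coeff_single, Finset.sum_apply', Finsupp.single_apply]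
  rw [Finset.sum_eq_single g⁻¹]
  · simp
  · intro h _ hne
    rw [if_neg]
    intro e
    exact hne (eq_inv_of_mul_eq_one_left e)
  · simp

/-- Bi-translation becomes two-sided multiplication: `a · ȟ · b = ǩ` with `k(x) = h(b x a)`; so a
bi-invariant `J` has a two-sided-closed image `J̌` (THE step where bi-invariance is consumed; with
`a = 1` only — left-invariance — one gets a right ideal, cf. `gradedPricing_false_with_leftInv_only`). -/
theorem single_mul_invLift_mul_single [Fintype G] (h : G → ℂ) (a b : G) :
    MonoidAlgebra.single a 1 * (∑ x : G, MonoidAlgebra.single x (h x⁻¹)) * MonoidAlgebra.single b 1 =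
      ∑ x : G, MonoidAlgebra.single x ((fun y => h (b * y * a)) x⁻¹) := by
  simp only [Finset.mul_sum, Finset.sum_mul, MonoidAlgebra.single_mul_single, one_mul, mul_one]
  exact Fintype.sum_equiv ((Equiv.mulLeft a).trans (Equiv.mulRight b)) _ _ fun x => by
    simp [mul_assoc]

/-- Read-out = trace form (Fourier inversion at `1`, tree `card_mul_coeff_one_eq_sum_trace`):
`|G| · f(g) = ∑_i d_i · tr (φ(f̌)_i · φ(g)_i)`. -/
theorem card_mul_apply_eq_sum_trace [Fintype G]
    (φ : MonoidAlgebra ℂ G ≃ₐ[ℂ] BlockAlgebraC d) (f : G → ℂ) (g : G) :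
    (Fintype.card G : ℂ) * f g =
      ∑ i, (d i : ℂ) * Matrix.trace (φ (∑ h : G, MonoidAlgebra.single h (f h⁻¹)) i *
        φ (MonoidAlgebra.single g 1) i) := by
  have h := card_mul_coeff_one_eq_sum_trace φ
    ((∑ h : G, MonoidAlgebra.single h (f h⁻¹)) * MonoidAlgebra.single g 1)
  rw [coeff_one_invLift_mul_single] at h
  rw [h]
  simp only [map_mul, Pi.mul_apply]

/-! ## The registered stubs (`sorry` only here; stated over existing declarations only) -/

/-- **stub_support (M, hardest) — Fourier-support lemma.** If `J` is bi-invariant and some `f ∈ J`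
has a non-zero `i`-th Fourier coefficient `φ(f̌)ᵢ ≠ 0` (`f̌ = ∑ g, single g (f g⁻¹)`), then the block
character `χᵢ` lies in `J`.  Route: `J̌ := {ǩ : k ∈ J}` is closed under `u · (·) · v`
(`single_mul_invLift_mul_single` + linearity); an entry `(a,b) ≠ 0` of `φ(f̌)ᵢ` and the sandwiches
`Pi.single i (E_ca) · φ(f̌) · Pi.single i (E_bc) = φ(f̌)ᵢ[a,b] · Pi.single i (E_cc)`
(`Matrix.single_mul_mul_single`) put `Pi.single i 1 ∈ φ(J̌)`; the `k ∈ J` with `ǩ = φ⁻¹(Pi.single i 1)`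
has `|G|·k = dᵢ·χᵢ` (`card_mul_apply_eq_sum_trace`, `character_blockRep_apply`), `dᵢ ≠ 0`. -/
theorem stub_support {G : Type} [Group G] [Fintype G] {r : ℕ} {d : Fin r → ℕ} [∀ i, NeZero (d i)]
    (φ : MonoidAlgebra ℂ G ≃ₐ[ℂ] Literature.RepresentationTheory.FiniteGroups.BlockAlgebraC d)
    (J : Submodule ℂ (G → ℂ)) (hJ : ∀ f ∈ J, ∀ a b : G, (fun g : G => f (a * g * b)) ∈ J)
    {f : G → ℂ} (hf : f ∈ J) {i : Fin r}
    (hi : φ (∑ g : G, MonoidAlgebra.single g (f g⁻¹)) i ≠ 0) :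
    (Literature.RepresentationTheory.FiniteGroups.blockRep φ i).character ∈ J := by
  sorry

/-- **stub_expansion (S/M) — Fourier expansion at `1` onto the support.** If the Fourier transform
`φ(f̌)` vanishes on every block outside `{i : p i}`, then `f` is a linear combination of the matrix
coefficients `g ↦ (φ g)ᵢ[b,a]` of the blocks with `p i` (as `GL`-valued homs):
`|G|·f(g) = Σ_{i : p i} dᵢ Σ_{a,b} φ(f̌)ᵢ[a,b] · (φ g)ᵢ[b,a]` (`card_mul_apply_eq_sum_trace`),
`|G| ≠ 0` in `ℂ`, then `Submodule.sum_mem`/`smul_mem`/`subset_span`.  `J`-free. -/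
theorem stub_expansion {G : Type} [Group G] [Fintype G] {r : ℕ} {d : Fin r → ℕ}
    (φ : MonoidAlgebra ℂ G ≃ₐ[ℂ] Literature.RepresentationTheory.FiniteGroups.BlockAlgebraC d)
    (p : Fin r → Prop) (f : G → ℂ)
    (hp : ∀ i, ¬ p i → φ (∑ g : G, MonoidAlgebra.single g (f g⁻¹)) i = 0) :
    f ∈ Literature.Computability.AlgebraicComplexity.repFun (fun i : {i : Fin r // p i} => d i.1)
      (fun i => ((((Pi.evalAlgHom ℂ (fun j : Fin r => Matrix (Fin (d j)) (Fin (d j)) ℂ) i.1).comp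
        φ.toAlgHom).toMonoidHom).comp (MonoidAlgebra.of ℂ G)).toHomUnits) := by
  sorry

/-! ## Dictionary and budget (PROVED support lemmas) -/

/-- **The inversion dictionary** (support lemma, PROVED; proof verbatim from `SketchIdeator1.lean`, `bcgpu_hypotheses_of_separated`, ideator 1). A `J`-separated triple (route convention:
words `x⁻¹ y y'⁻¹ z`, Kronecker pattern, BOTH halves) with `Y ≠ ∅` yields, for the inverted triple
`(X⁻¹, Y⁻¹, Z⁻¹)`, the embedding-form TPP and a BCGPU separating family (Def. 2.1) drawn from `J`
(`f'_{x',z'} := f_{x'⁻¹, z'⁻¹}`; the value `1` at `x' z'⁻¹ = x⁻¹·y₀·y₀⁻¹·z` needs some `y₀ ∈ Y`;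
`Finset.mem_inv'`, `inv_injective`, `group`). -/
theorem sep_inv_dictionary (J : Submodule ℂ (G → ℂ)) (X Y Z : Finset G) (hY : Y.Nonempty)
    (hsep : ∀ x₀ ∈ X, ∀ z₀ ∈ Z, ∃ f ∈ J, ∀ x ∈ X, ∀ y ∈ Y, ∀ y' ∈ Y, ∀ z ∈ Z,
      (x = x₀ ∧ y = y' ∧ z = z₀ → f (x⁻¹ * y * y'⁻¹ * z) = 1) ∧
      (¬ (x = x₀ ∧ y = y' ∧ z = z₀) → f (x⁻¹ * y * y'⁻¹ * z) = 0)) :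
    (∀ x ∈ X⁻¹, ∀ x' ∈ X⁻¹, ∀ y ∈ Y⁻¹, ∀ y' ∈ Y⁻¹, ∀ z ∈ Z⁻¹, ∀ z' ∈ Z⁻¹,
      x * y⁻¹ * y' * z⁻¹ = x' * z'⁻¹ → x = x' ∧ y = y' ∧ z = z') ∧
    ∃ f : G → G → (G → ℂ),
      Literature.Computability.AlgebraicComplexity.IsSeparatingFamily X⁻¹ Y⁻¹ Z⁻¹ f ∧
      ∀ x ∈ X⁻¹, ∀ z ∈ Z⁻¹, f x z ∈ J := by
  obtain ⟨y₀, hy₀⟩ := hY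
  have memX : ∀ {x : G}, x ∈ X⁻¹ → x⁻¹ ∈ X := fun h => Finset.mem_inv'.1 h
  have memY : ∀ {y : G}, y ∈ Y⁻¹ → y⁻¹ ∈ Y := fun h => Finset.mem_inv'.1 h
  have memZ : ∀ {z : G}, z ∈ Z⁻¹ → z⁻¹ ∈ Z := fun h => Finset.mem_inv'.1 h
  constructor
  · -- embedding-form TPP for `(X⁻¹, Y⁻¹, Z⁻¹)` from separation (value `0` off the pattern)
    intro x hx x' hx' y hy y' hy' z hz z' hz' he
    obtain ⟨f, -, hf⟩ := hsep x'⁻¹ (memX hx') z'⁻¹ (memZ hz')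
    have h1 : f (x'⁻¹⁻¹ * y₀ * y₀⁻¹ * z'⁻¹) = 1 :=
      (hf _ (memX hx') _ hy₀ _ hy₀ _ (memZ hz')).1 ⟨rfl, rfl, rfl⟩
    have e1 : x'⁻¹⁻¹ * y₀ * y₀⁻¹ * z'⁻¹ = x' * z'⁻¹ := by group
    by_contra hne
    have h0 : f (x⁻¹⁻¹ * y⁻¹ * y'⁻¹⁻¹ * z⁻¹) = 0 :=
      (hf _ (memX hx) _ (memY hy) _ (memY hy') _ (memZ hz)).2
        (fun ⟨h1', h2', h3'⟩ => hne ⟨inv_injective h1', inv_injective h2', inv_injective h3'⟩)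
    have e0 : x⁻¹⁻¹ * y⁻¹ * y'⁻¹⁻¹ * z⁻¹ = x * y⁻¹ * y' * z⁻¹ := by simp only [inv_inv]
    rw [e0, he, ← e1, h1] at h0
    exact one_ne_zero h0
  · -- the separating family, drawn from `J` (value `1` on the pattern needs `y₀ ∈ Y`)
    choose! fsep hfsepJ hfsep using hsep
    refine ⟨fun x z => fsep x⁻¹ z⁻¹, ?_, ?_⟩
    · intro x hx z hz
      have hf := hfsep x⁻¹ (memX hx) z⁻¹ (memZ hz)
      refine ⟨?_, ?_⟩
      · have h1 := (hf _ (memX hx) _ hy₀ _ hy₀ _ (memZ hz)).1 ⟨rfl, rfl, rfl⟩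
        have e1 : x⁻¹⁻¹ * y₀ * y₀⁻¹ * z⁻¹ = x * z⁻¹ := by group
        rwa [e1] at h1
      · intro x' hx' y hy y' hy' z' hz' hne
        have h0 := (hf _ (memX hx') _ (memY hy) _ (memY hy') _ (memZ hz')).2 (by
          rintro ⟨h1', h2', h3'⟩
          apply hne
          have ex : x' = x := inv_injective h1'
          have ey : y = y' := inv_injective h2'
          have ez : z' = z := inv_injective h3'
          subst ex; subst ey; subst ez
          group)
        have e0 : x'⁻¹⁻¹ * y⁻¹ * y'⁻¹⁻¹ * z'⁻¹ = x' * y⁻¹ * y' * z'⁻¹ := by simp only [inv_inv]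
        rwa [e0] at h0
    · intro x hx z hz
      exact hfsepJ x⁻¹ (memX hx) z⁻¹ (memZ hz)

/-- **Budget comparison** (support lemma, PROVED; proof verbatim from `SketchIdeator1.lean`, `sum_visibleBlocks_rpow_le`, ideator 1). The blocks whose character lies in `J` have pairwise
distinct irreducible characters (`character_blockRep_injective`, `isIrreducible_blockRep`) in the
finite set `Irr(G) ∩ J` (`irrChars_finite_holds`), of degrees `dᵢ = χᵢ(1)` (`Representation.char_one`);
all terms are `≥ 0` (`IsIrrChar.exists_apply_one`). -/
theorem sum_charSupport_rpow_le [Fintype G] [∀ i, NeZero (d i)]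
    (φ : MonoidAlgebra ℂ G ≃ₐ[ℂ] Literature.RepresentationTheory.FiniteGroups.BlockAlgebraC d)
    (J : Submodule ℂ (G → ℂ)) (s : ℝ) :
    ∑ i : {i : Fin r // (Literature.RepresentationTheory.FiniteGroups.blockRep φ i).character ∈ J},
        (d i.1 : ℝ) ^ s ≤
      ∑ᶠ χ ∈ Literature.RepresentationTheory.FiniteGroups.irrChars G ∩ (J : Set (G → ℂ)),
        (χ 1).re ^ s := by
  have hfin : (irrChars G ∩ (J : Set (G → ℂ))).Finite :=
    (irrChars_finite_holds G).subset Set.inter_subset_left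
  rw [finsum_mem_eq_finite_toFinset_sum _ hfin]
  set χ : {i : Fin r // (blockRep φ i).character ∈ J} → (G → ℂ) :=
    fun i => (blockRep φ i.1).character with hχ
  have hinj : Function.Injective χ := fun i j h =>
    Subtype.ext (character_blockRep_injective φ h)
  have hmem : ∀ i, χ i ∈ irrChars G ∩ (J : Set (G → ℂ)) := fun i =>
    ⟨⟨Fin (d i.1) → ℂ, inferInstance, inferInstance, inferInstance, blockRep φ i.1,
      isIrreducible_blockRep φ i.1, rfl⟩, i.2⟩
  have hdeg : ∀ i, ((χ i 1).re : ℝ) = d i.1 := fun i => by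
    simp [hχ, Representation.char_one]
  have h1 : ∑ i : {i : Fin r // (blockRep φ i).character ∈ J}, (d i.1 : ℝ) ^ s =
      ∑ ψ ∈ Finset.univ.image χ, (ψ 1).re ^ s := by
    rw [Finset.sum_image fun i _ j _ h => hinj h]
    exact Finset.sum_congr rfl fun i _ => by rw [hdeg]
  rw [h1]
  refine Finset.sum_le_sum_of_subset_of_nonneg ?_ fun ψ hψ _ => ?_
  · intro ψ hψ
    rw [Finset.mem_image] at hψ
    obtain ⟨i, _, rfl⟩ := hψ
    exact hfin.mem_toFinset.2 (hmem i)
  · obtain ⟨n, -, hn⟩ := IsIrrChar.exists_apply_one (hfin.mem_toFinset.1 hψ).1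
    rw [hn]
    exact Real.rpow_nonneg (by simp) _

/-! ## The transfer `C⁺` (derived) and the composition (REAL proofs) -/

/-- **TRANSFER `C⁺` — Peter–Weyl containment.** A bi-invariant `J` consists of representative
functions of the Wedderburn blocks whose characters it contains: `J ≤ repFun {i : χᵢ ∈ J}`
(from `stub_support`, contrapositively, and `stub_expansion`). -/
theorem le_repFun_charSupport [Fintype G] [∀ i, NeZero (d i)]
    (φ : MonoidAlgebra ℂ G ≃ₐ[ℂ] BlockAlgebraC d) (J : Submodule ℂ (G → ℂ))
    (hJ : ∀ f ∈ J, ∀ a b : G, (fun g : G => f (a * g * b)) ∈ J) :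
    J ≤ repFun (fun i : {i : Fin r // (blockRep φ i).character ∈ J} => d i.1)
      (fun i => ((((Pi.evalAlgHom ℂ (fun j : Fin r => Matrix (Fin (d j)) (Fin (d j)) ℂ) i.1).comp
        φ.toAlgHom).toMonoidHom).comp (MonoidAlgebra.of ℂ G)).toHomUnits) := by
  intro f hf
  refine stub_expansion φ (fun i => (blockRep φ i).character ∈ J) f fun i hi => ?_
  by_contra hne
  exact hi (stub_support φ J hJ hf hne)

/-- **COMPOSITION — the line concludes the crux BY NAME.** `sep_inv_dictionary` + `C⁺` feed the tree's
PROVED `BCGPU2024_thm_2_2_corrected_holds` (BCGPU 2024 Thm 2.2, embedding TPP) on `(X⁻¹, Y⁻¹, Z⁻¹)`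
with `R_sep := {i // χᵢ ∈ J}`; `Finset.card_inv`; `sum_charSupport_rpow_le` at `s = ω`.  The zero-volume corner
(in particular `Y = ∅`) is `0^(ω/3) = 0 ≤ Σᶠ ≥ 0`. -/
theorem GradedPricing_of :
    Summit.MatrixMultiplication.MatrixMultiplication.Theses.LevelGradedCohnUmans.GradedPricing := by
  intro G _ _ J hJ X Y Z hsep
  have hω0 : 0 < omega ℂ := zero_lt_two.trans_le (omega_two_le (K := ℂ))
  have hfin : (irrChars G ∩ (J : Set (G → ℂ))).Finite :=
    (irrChars_finite_holds G).subset Set.inter_subset_left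
  rcases Nat.eq_zero_or_pos (X.card * Y.card * Z.card) with hq | hq
  · -- zero volume: `0 ≤ Σᶠ`
    rw [hq, Nat.cast_zero, Real.zero_rpow (div_pos hω0 three_pos).ne',
      finsum_mem_eq_finite_toFinset_sum _ hfin]
    exact Finset.sum_nonneg fun ψ hψ => by
      obtain ⟨n, -, hn⟩ := IsIrrChar.exists_apply_one (hfin.mem_toFinset.1 hψ).1
      rw [hn]
      exact Real.rpow_nonneg (by simp) _
  · have hY : Y.Nonempty := Finset.card_pos.1 (Nat.pos_of_ne_zero fun h => by simp [h] at hq)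
    obtain ⟨r, d, hd, ⟨φ⟩⟩ := exists_algEquiv_pi_matrix G
    haveI := hd
    obtain ⟨hTPP, fsep, hfsep, hmemJ⟩ := sep_inv_dictionary J X Y Z hY hsep
    have hmem : ∀ x ∈ X⁻¹, ∀ z ∈ Z⁻¹, fsep x z ∈
        repFun (fun i : {i : Fin r // (blockRep φ i).character ∈ J} => d i.1)
          (fun i => ((((Pi.evalAlgHom ℂ (fun j : Fin r => Matrix (Fin (d j)) (Fin (d j)) ℂ) i.1).comp
            φ.toAlgHom).toMonoidHom).comp (MonoidAlgebra.of ℂ G)).toHomUnits) :=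
      fun x hx z hz => le_repFun_charSupport φ J hJ (hmemJ x hx z hz)
    have key := BCGPU2024_thm_2_2_corrected_holds G X⁻¹ Y⁻¹ Z⁻¹ hTPP
      {i : Fin r // (blockRep φ i).character ∈ J} (fun i => d i.1)
      (fun i => ((((Pi.evalAlgHom ℂ (fun j : Fin r => Matrix (Fin (d j)) (Fin (d j)) ℂ) i.1).comp
        φ.toAlgHom).toMonoidHom).comp (MonoidAlgebra.of ℂ G)).toHomUnits) fsep hfsep hmem
    rw [Finset.card_inv, Finset.card_inv, Finset.card_inv] at key
    exact key.trans (sum_charSupport_rpow_le φ J (omega ℂ))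

end Summit.MatrixMultiplication.MatrixMultiplication.Cruxes.GradedPricing.FourierSupportRepfun

end
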